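import Summits.AtomisticToContinuum.Crystallization.Theorems.OverbindingBudgetAffineCompressedCutOp
import Summits.AtomisticToContinuum.Crystallization.Theorems.OverbindingBudgetAffineRunCutAxisFingerprint

/-!
# `OverbindingBudget` / crux `RobustDefectLimitWindows` (stmt-AtomisticToContinuum-31280) — «RunCut»: LETTER CONSTANCY ALONG BASAL BONDS, part A (the finite facts)

Support file (lens-4 g88, part 16A; memo `g87/memo/SW-CHI.md` §10.8, critic row 1574 (B)(i)).  Three more `decide` facts of the `√18` integer model
`hcpModelInt` of the hcp two-shell pattern (`…TwoShellIntegerModel`), complementing `…RunCutAxisFingerprint` (a)–(d), and their real forms on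
`hcpTwoShellPattern` — the finite core of the BASAL STEP `…RunCutSheetLetter.basal_step_record` (part 16B: an h-site's basal neighbours are h-sites
with the same layer normal, and it lies in their basal planes):
* (e) `hcpModelInt_basal_of_eclipsed_contacts` / `hcpTwoShellPattern_basal_of_eclipsed_contacts` — **a pattern point at contact distance from both
  members of an eclipsed pair (`dist² = 8/3`) is basal** (the eclipsed pairs are mirror pairs of the basal plane);
* (f) `hcpModelInt_sub_contact_trichotomy` / `hcpTwoShellPattern_dist_sq_contact_trichotomy` — **the contact gap**: two pattern points are equal, at
  distance `1`, or at `dist² ≥ 2`;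
* (g) `hcpModelInt_basal_firstShell_cap_pair` / `hcpTwoShellPattern_basal_cap_pair` — **a basal point `u` carries a first-shell eclipsed CAP PAIR**: unit
  pattern vectors `w₁, w₂` at contact distance from `u` with `w₁ − w₂ = (4,4,4)/√18` (sharpens `…AxisFingerprint.hcpModelInt_basal_sees_eclipsed_pair`,
  which does not record the shell);
plus the glue `coordSum_eq_zero_iff`, `norm_eq_one_of_basal` (basal points are unit vectors; via the tree's `…CompressedCutOp.norm_eq_one_of_sqNormInt`) and the window
`1.6329 ≤ ‖(4,4,4)/√18‖ ≤ 1.633` (`norm_eclipsedVec_bounds`).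
[this file: 0 definitions, 9 theorems; imports tree `…CompressedCutOp` and `…RunCutAxisFingerprint` only; standard axioms]
-/

namespace Summit.AtomisticToContinuum.Crystallization.Theorems.OverbindingBudgetAffineRunCutSheetLetterA

open Literature.Geometry.DiscreteGeometry
open Summit.AtomisticToContinuum.Crystallization.Theorems.OverbindingBudgetAffineRunCutAxisFingerprint
open Summit.AtomisticToContinuum.Crystallization.Theorems.OverbindingBudgetAffineCompressedCutOp (norm_eq_one_of_sqNormInt)

local notation "E3" => EuclideanSpace ℝ (Fin 3)

/-! ## §1 Three integer facts of the hcp model (`decide`) -/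

/-- (e) **A pattern point at contact distance from both members of an eclipsed pair is basal**: in the `√18` model, if `v − w` is an
eclipsed pair (squared distance `48`) and `x` is at squared distance `18` from `v` and from `w`, then `x₀ + x₁ + x₂ = 0`. [this file · kind: computation] -/
theorem hcpModelInt_basal_of_eclipsed_contacts : ∀ v ∈ hcpModelInt, ∀ w ∈ hcpModelInt, sqNormInt (v - w) = 48 →
    ∀ x ∈ hcpModelInt, sqNormInt (x - v) = 18 → sqNormInt (x - w) = 18 → x 0 + x 1 + x 2 = 0 := by
  decide

/-- (f) **The contact gap**: two points of the hcp model are equal, at squared distance `18`, or at squared distance `≥ 36`. [this file · kind: computation] -/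
theorem hcpModelInt_sub_contact_trichotomy : ∀ v ∈ hcpModelInt, ∀ w ∈ hcpModelInt,
    sqNormInt (v - w) = 0 ∨ sqNormInt (v - w) = 18 ∨ 36 ≤ sqNormInt (v - w) := by
  decide

/-- (g) **A basal point carries a FIRST-SHELL eclipsed cap pair at contact distance** (sharpens `…AxisFingerprint.hcpModelInt_basal_sees_eclipsed_pair`,
which does not record the shell). [this file · kind: computation] -/
theorem hcpModelInt_basal_firstShell_cap_pair : ∀ v ∈ hcpModelInt, v 0 + v 1 + v 2 = 0 →
    ∃ w₁ ∈ hcpInt, ∃ w₂ ∈ hcpInt, sqNormInt (w₁ - v) = 18 ∧ sqNormInt (w₂ - v) = 18 ∧ w₁ - w₂ = ![4, 4, 4] := by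
  decide

/-! ## §2 The same facts on the real pattern `hcpTwoShellPattern` (scale `1/√18`) -/

/-- The coordinate sum of a model point vanishes iff that of its integer label does. [this file · kind: glue] -/
theorem coordSum_eq_zero_iff (v : Fin 3 → ℤ) :
    ((Real.sqrt 18)⁻¹ • intVec v : E3) 0 + ((Real.sqrt 18)⁻¹ • intVec v : E3) 1 + ((Real.sqrt 18)⁻¹ • intVec v : E3) 2 = 0 ↔
      v 0 + v 1 + v 2 = 0 := by
  simp only [PiLp.smul_apply, intVec_apply, smul_eq_mul]
  rw [← mul_add, ← mul_add]
  have hs : ((v 0 : ℝ) + (v 1 : ℝ) + (v 2 : ℝ)) = ((v 0 + v 1 + v 2 : ℤ) : ℝ) := by push_cast; ring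
  rw [hs]
  have h18 : (Real.sqrt 18)⁻¹ ≠ 0 := inv_ne_zero (Real.sqrt_ne_zero'.2 (by norm_num))
  constructor
  · intro h
    exact_mod_cast (mul_eq_zero.1 h).resolve_left h18
  · intro h
    rw [h]; simp

/-- **A basal point of the hcp two-shell pattern is a first-shell (unit) vector.** [this file · kind: proof] -/
theorem norm_eq_one_of_basal {u : E3} (hu : u ∈ hcpTwoShellPattern) (hu0 : u 0 + u 1 + u 2 = 0) : ‖u‖ = 1 := by
  rw [hcpTwoShellPattern_eq_image] at hu
  obtain ⟨U, hU, rfl⟩ := Finset.mem_image.1 hu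
  simp only [Nat.cast_ofNat] at hu0 ⊢
  exact norm_eq_one_of_sqNormInt (card_hcpModelInt_basal.2 U hU ((coordSum_eq_zero_iff U).1 hu0))

/-- ★ (g) on the real pattern: **a basal point `u` has two unit pattern vectors `w₁, w₂` at contact distance `1` from it with `w₁ − w₂` the
eclipsed-pair vector `(4,4,4)/√18`** (the caps above and below one of the two basal triangles at `u`). [this file · kind: proof] -/
theorem hcpTwoShellPattern_basal_cap_pair {u : E3} (hu : u ∈ hcpTwoShellPattern) (hu0 : u 0 + u 1 + u 2 = 0) :
    ∃ w₁ ∈ hcpTwoShellPattern, ∃ w₂ ∈ hcpTwoShellPattern,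
      ‖w₁‖ = 1 ∧ ‖w₂‖ = 1 ∧ dist w₁ u = 1 ∧ dist w₂ u = 1 ∧ w₁ - w₂ = (Real.sqrt 18)⁻¹ • intVec ![4, 4, 4] := by
  rw [hcpTwoShellPattern_eq_image] at hu
  obtain ⟨U, hU, rfl⟩ := Finset.mem_image.1 hu
  simp only [Nat.cast_ofNat] at hu0 ⊢
  obtain ⟨W₁, hW₁, W₂, hW₂, h₁, h₂, hW⟩ := hcpModelInt_basal_firstShell_cap_pair U hU ((coordSum_eq_zero_iff U).1 hu0)
  have hW₁M : W₁ ∈ hcpModelInt := Finset.mem_union_left _ hW₁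
  have hW₂M : W₂ ∈ hcpModelInt := Finset.mem_union_left _ hW₂
  have hd : ∀ W : Fin 3 → ℤ, sqNormInt (W - U) = 18 → dist ((Real.sqrt 18)⁻¹ • intVec W : E3) ((Real.sqrt 18)⁻¹ • intVec U) = 1 := by
    intro W hWU
    have h2 : dist ((Real.sqrt 18)⁻¹ • intVec W : E3) ((Real.sqrt 18)⁻¹ • intVec U) ^ 2 = 1 := by
      rw [dist_sq_intVec_div]
      have : (sqNormInt (W - U) : ℝ) = 18 := by exact_mod_cast hWU
      rw [this]; norm_num
    nlinarith [dist_nonneg (x := ((Real.sqrt 18)⁻¹ • intVec W : E3)) (y := (Real.sqrt 18)⁻¹ • intVec U)]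
  refine ⟨(Real.sqrt 18)⁻¹ • intVec W₁, ?_, (Real.sqrt 18)⁻¹ • intVec W₂, ?_,
    norm_eq_one_of_sqNormInt (sqNormInt_hcpInt W₁ hW₁), norm_eq_one_of_sqNormInt (sqNormInt_hcpInt W₂ hW₂), hd W₁ h₁, hd W₂ h₂, ?_⟩
  · rw [hcpTwoShellPattern_eq_image]; simp only [Nat.cast_ofNat]; exact Finset.mem_image_of_mem _ hW₁M
  · rw [hcpTwoShellPattern_eq_image]; simp only [Nat.cast_ofNat]; exact Finset.mem_image_of_mem _ hW₂M
  · rw [← smul_sub, intVec_sub, hW]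

/-- ★ (f) on the real pattern: **two points of `hcpTwoShellPattern` are equal, at distance `1`, or at `dist² ≥ 2`.** [this file · kind: proof] -/
theorem hcpTwoShellPattern_dist_sq_contact_trichotomy : ∀ x ∈ hcpTwoShellPattern, ∀ y ∈ hcpTwoShellPattern,
    dist x y ^ 2 = 0 ∨ dist x y ^ 2 = 1 ∨ 2 ≤ dist x y ^ 2 := by
  intro x hx y hy
  rw [hcpTwoShellPattern_eq_image] at hx hy
  obtain ⟨v, hv, rfl⟩ := Finset.mem_image.1 hx
  obtain ⟨w, hw, rfl⟩ := Finset.mem_image.1 hy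
  simp only [Nat.cast_ofNat]
  rw [dist_sq_intVec_div]
  rcases hcpModelInt_sub_contact_trichotomy v hv w hw with h | h | h
  · left
    have h' : (sqNormInt (v - w) : ℝ) = 0 := by exact_mod_cast h
    rw [h']; norm_num
  · right; left
    have h' : (sqNormInt (v - w) : ℝ) = 18 := by exact_mod_cast h
    rw [h']; norm_num
  · right; right
    have h' : (36 : ℝ) ≤ (sqNormInt (v - w) : ℝ) := by exact_mod_cast h
    linarith

/-- ★ (e) on the real pattern: **a point of `hcpTwoShellPattern` at distance `1` from both ends of an eclipsed pair (`dist² = 8/3`) is basal.**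
[this file · kind: proof] -/
theorem hcpTwoShellPattern_basal_of_eclipsed_contacts : ∀ x₁ ∈ hcpTwoShellPattern, ∀ x₂ ∈ hcpTwoShellPattern, dist x₁ x₂ ^ 2 = 8 / 3 →
    ∀ x₀ ∈ hcpTwoShellPattern, dist x₀ x₁ ^ 2 = 1 → dist x₀ x₂ ^ 2 = 1 → x₀ 0 + x₀ 1 + x₀ 2 = 0 := by
  intro x₁ hx₁ x₂ hx₂ h12 x₀ hx₀ h01 h02
  rw [hcpTwoShellPattern_eq_image] at hx₁ hx₂ hx₀
  obtain ⟨X₁, hX₁, rfl⟩ := Finset.mem_image.1 hx₁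
  obtain ⟨X₂, hX₂, rfl⟩ := Finset.mem_image.1 hx₂
  obtain ⟨X₀, hX₀, rfl⟩ := Finset.mem_image.1 hx₀
  simp only [Nat.cast_ofNat] at h12 h01 h02 ⊢
  rw [dist_sq_intVec_div] at h12 h01 h02
  have e12 : sqNormInt (X₁ - X₂) = 48 := by
    have : (sqNormInt (X₁ - X₂) : ℝ) = 48 := by linarith
    exact_mod_cast this
  have e01 : sqNormInt (X₀ - X₁) = 18 := by
    have : (sqNormInt (X₀ - X₁) : ℝ) = 18 := by linarith
    exact_mod_cast this
  have e02 : sqNormInt (X₀ - X₂) = 18 := by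
    have : (sqNormInt (X₀ - X₂) : ℝ) = 18 := by linarith
    exact_mod_cast this
  exact (coordSum_eq_zero_iff X₀).2 (hcpModelInt_basal_of_eclipsed_contacts X₁ hX₁ X₂ hX₂ e12 X₀ hX₀ e01 e02)

/-- `1.6329 ≤ ‖(4,4,4)/√18‖ ≤ 1.633` (`‖·‖² = 8/3`, `…AxisFingerprint.norm_sq_eclipsedVec`). [this file · kind: glue] -/
theorem norm_eclipsedVec_bounds : (16329 / 10000 : ℝ) ≤ ‖((Real.sqrt 18)⁻¹ • intVec ![4, 4, 4] : E3)‖ ∧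
    ‖((Real.sqrt 18)⁻¹ • intVec ![4, 4, 4] : E3)‖ ≤ 1633 / 1000 := by
  have h := norm_sq_eclipsedVec
  have h0 := norm_nonneg ((Real.sqrt 18)⁻¹ • intVec ![4, 4, 4] : E3)
  constructor <;> nlinarith

end Summit.AtomisticToContinuum.Crystallization.Theorems.OverbindingBudgetAffineRunCutSheetLetterA
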